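import Summits.CriticalPhenomena.PercolationContinuityZ3.Theorems.PercNearOneGluingNoHeavyLowerTailKnQuestion8CoefficientwiseHarris
import HarnessLib

/-!
# The absorption lemma: an injective pairing of crossings with spanning absorbers makes a difference-square form monotone-positive
# (prim-lf-2 gen 28)

Support file (`--supports stmt-CriticalPhenomena-4575`, closed), prover `prim-lf-2` (gen 28).  No definitions, no named facts, no sorries;
standard axioms.  Memo `prim-lf-2/CW-RR0-gen28.md` §2.

All kernels of the coefficientwise programme are configuration sums `Σ_{c ∈ 𝒜} (f(a_c) − f(b_c))·(g(a_c) − g(b_c))` of pairs of vertex sets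
(`a_c` = red cluster, `b_c` = blue cluster of the root) tested against monotone `f, g`.  A pair with `b_c ⊆ a_c` or `a_c ⊆ b_c` ('comparable',
an *absorber*) contributes `≥ 0`; an incomparable pair (a *crossing*) may contribute `< 0`.  The lemma below is the integral form of the programme's
LP certificates and of prim-cplus-coupling's 'MASTER injection': if the crossings can be sent INJECTIVELY to absorbers whose upper set contains
`a_c ∪ b_c` and whose lower set lies inside `a_c ∩ b_c`, the whole sum is nonnegative, because such an absorber pays at least
`|f(a_c) − f(b_c)|·|g(a_c) − g(b_c)|`.

* `Coefficientwise.absorb_pair_nonneg` — the pointwise step: `(f a − f b)(g a − g b) + (f a' − f b')(g a' − g b') ≥ 0` whenever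
  `a ∪ b ⊆ a'` and `b' ⊆ a ∩ b`;
* `Coefficientwise.absorption_nonneg` — the lemma: an injection `Ψ` from a set `N ⊇ {crossings}` into the absorbers outside `N`, with
  `a_c ∪ b_c ⊆ a_{Ψ c}` and `b_{Ψ c} ⊆ a_c ∩ b_c`, gives `0 ≤ Σ_{c ∈ 𝒜} (f(a_c) − f(b_c))(g(a_c) − g(b_c))`.
Application (memo §2, proved there): RR₀ — positivity of the red-reached two-colouring form — for every CYCLE through the root `x` and the target `v`,
via the explicit injection 'complement the initial blue run of the non-red arc together with its terminating edge'; for three or more internally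
disjoint `x–v` paths no such injection exists (θ(2,2,2): Hall deficiency 2) although the form is still nonnegative.
[cite: KozmaNitzan2024, Questions 8–9 (§5.5 p. 36) (context: first rung of the coefficientwise programme for Question 8)]
-/

namespace Summit.CriticalPhenomena.PercolationContinuityZ3.Theorems

open Finset

namespace Coefficientwise

variable {V : Type*}

/-- Pointwise absorption: a comparable pair `(a', b')` spanning an arbitrary pair `(a, b)` (`a ∪ b ⊆ a'`, `b' ⊆ a ∩ b`) pays for it:
`0 ≤ (f a − f b)(g a − g b) + (f a' − f b')(g a' − g b')` for monotone `f, g`.  [cite: KozmaNitzan2024, §5.5 (context only)] -/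
theorem absorb_pair_nonneg (f g : Set V → ℝ) (hf : Monotone f) (hg : Monotone g) {a b a' b' : Set V}
    (hup : a ∪ b ⊆ a') (hdown : b' ⊆ a ∩ b) :
    0 ≤ (f a - f b) * (g a - g b) + (f a' - f b') * (g a' - g b') := by
  have ha : a ⊆ a' := Set.subset_union_left.trans hup
  have hb : b ⊆ a' := Set.subset_union_right.trans hup
  have ha' : b' ⊆ a := hdown.trans Set.inter_subset_left
  have hb' : b' ⊆ b := hdown.trans Set.inter_subset_right
  have f1 := hf ha; have f2 := hf hb; have f3 := hf ha'; have f4 := hf hb'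
  have g1 := hg ha; have g2 := hg hb; have g3 := hg ha'; have g4 := hg hb'
  -- `f a' − f b' ≥ |f a − f b|` and likewise for `g`
  rcases le_total (f a) (f b) with hfab | hfab <;> rcases le_total (g a) (g b) with hgab | hgab
  · nlinarith [mul_nonneg (sub_nonneg.mpr hfab) (sub_nonneg.mpr hgab)]
  · nlinarith [mul_nonneg (sub_nonneg.mpr hfab) (sub_nonneg.mpr hgab),
      mul_nonneg (sub_nonneg.mpr (show f b ≤ f a' - f b' + f a by linarith)) (sub_nonneg.mpr hgab)]
  · nlinarith [mul_nonneg (sub_nonneg.mpr hfab) (sub_nonneg.mpr hgab),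
      mul_nonneg (sub_nonneg.mpr hfab) (sub_nonneg.mpr (show g b ≤ g a' - g b' + g a by linarith))]
  · nlinarith [mul_nonneg (sub_nonneg.mpr hfab) (sub_nonneg.mpr hgab)]

/-- **Absorption lemma.**  Let `(a_c, b_c)_{c ∈ 𝒜}` be pairs of sets and `f, g` monotone.  Suppose `N ⊆ 𝒜` contains every crossing (every
`c ∈ 𝒜 ∖ N` off the image of `Ψ` has `b_c ⊆ a_c` or `a_c ⊆ b_c`) and `Ψ` maps `N` injectively into `𝒜 ∖ N` with `a_c ∪ b_c ⊆ a_{Ψ c}` and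
`b_{Ψ c} ⊆ a_c ∩ b_c`.  Then `0 ≤ Σ_{c ∈ 𝒜} (f(a_c) − f(b_c))·(g(a_c) − g(b_c))`.  (RR₀ for cycles, memo CW-RR0-gen28 §2; the general integral form
of an elementary certificate.)  [cite: KozmaNitzan2024, Questions 8–9 (§5.5 p. 36) (context)] -/
theorem absorption_nonneg {κ : Type*} [DecidableEq κ] (A N : Finset κ) (hN : N ⊆ A) (a b : κ → Set V) (Ψ : κ → κ)
    (f g : Set V → ℝ) (hf : Monotone f) (hg : Monotone g)
    (hΨA : ∀ c ∈ N, Ψ c ∈ A) (hΨN : ∀ c ∈ N, Ψ c ∉ N) (hinj : ∀ c ∈ N, ∀ c' ∈ N, Ψ c = Ψ c' → c = c')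
    (hup : ∀ c ∈ N, a c ∪ b c ⊆ a (Ψ c)) (hdown : ∀ c ∈ N, b (Ψ c) ⊆ a c ∩ b c)
    (hcomp : ∀ c ∈ A, c ∉ N → c ∉ N.image Ψ → (b c ⊆ a c ∨ a c ⊆ b c)) :
    0 ≤ ∑ c ∈ A, (f (a c) - f (b c)) * (g (a c) - g (b c)) := by
  set val : κ → ℝ := fun c => (f (a c) - f (b c)) * (g (a c) - g (b c)) with hval
  change 0 ≤ ∑ c ∈ A, val c
  -- split `A` into `N`, the image of `Ψ`, and the rest
  have hsplit1 : ∑ c ∈ A, val c = ∑ c ∈ A.filter (fun c => c ∈ N), val c + ∑ c ∈ A.filter (fun c => c ∉ N), val c :=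
    (Finset.sum_filter_add_sum_filter_not A (fun c => c ∈ N) val).symm
  have hfN : A.filter (fun c => c ∈ N) = N := by
    ext c; simp only [Finset.mem_filter]; exact ⟨fun h => h.2, fun h => ⟨hN h, h⟩⟩
  have hsplit2 : ∑ c ∈ A.filter (fun c => c ∉ N), val c =
      ∑ c ∈ (A.filter (fun c => c ∉ N)).filter (fun c => c ∈ N.image Ψ), val c +
        ∑ c ∈ (A.filter (fun c => c ∉ N)).filter (fun c => c ∉ N.image Ψ), val c :=
    (Finset.sum_filter_add_sum_filter_not _ (fun c => c ∈ N.image Ψ) val).symm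
  have hfI : (A.filter (fun c => c ∉ N)).filter (fun c => c ∈ N.image Ψ) = N.image Ψ := by
    ext c
    simp only [Finset.mem_filter, Finset.mem_image]
    constructor
    · rintro ⟨_, h⟩; exact h
    · rintro ⟨c', hc', rfl⟩; exact ⟨⟨hΨA c' hc', hΨN c' hc'⟩, c', hc', rfl⟩
  have himage : ∑ c ∈ N.image Ψ, val c = ∑ c ∈ N, val (Ψ c) := Finset.sum_image hinj
  rw [hsplit1, hfN, hsplit2, hfI, himage, ← add_assoc, ← Finset.sum_add_distrib]
  refine add_nonneg (Finset.sum_nonneg fun c hc => ?_) (Finset.sum_nonneg fun c hc => ?_)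
  · exact absorb_pair_nonneg f g hf hg (hup c hc) (hdown c hc)
  · simp only [Finset.mem_filter] at hc
    obtain ⟨⟨hcA, hcN⟩, hcI⟩ := hc
    rcases hcomp c hcA hcN hcI with h | h
    · exact mul_nonneg (sub_nonneg.mpr (hf h)) (sub_nonneg.mpr (hg h))
    · exact mul_nonneg_of_nonpos_of_nonpos (sub_nonpos.mpr (hf h)) (sub_nonpos.mpr (hg h))

end Coefficientwise

end Summit.CriticalPhenomena.PercolationContinuityZ3.Theorems
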